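import Summits.BirchSwinnertonDyer.Rank1Residual.O5.HeegnerLogTransportThreeOrdSelmer
import Summits.BirchSwinnertonDyer.Rank1Residual.X11b.BDPRouteSelmerCountExact
import Summits.BirchSwinnertonDyer.Rank1Residual.X11b.BDPRouteSelmerCardBound
import HarnessLib
import HarnessLib.Audit.Tags

/-!
# O5 / C-KL3-V — KL3 part 10a: the EXACT base Selmer count `#Sel_𝔭(K, W[p^∞]) = p^a` at a rank-one
# datum under (iv) `W(ℚ_p)[p] = 0`, for EVERY prime `p` and EVERY reduction type, modulo the two textbook
# facts (Poitou–Tate duality for Selmer structures, local Euler characteristic) (cell `b2b-bsdres`, o5-r2 GEN 21)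

HONEST FRAMING (verbatim, cell `b2b-bsdres`, run/shared/lean/b2b/bsd-rank1-residual/): research route; O5
(tame potentially-supersingular additive `p = 3`, reading (t′)) is OPEN. A census is EVIDENCE toward the law
the cell is hunting, never a Literature fact. Nothing here is booked in Literature; no RESIDUAL-MAP mark moves.

## What this file does

The KL3 END theorems (parts 5–7, 9) consume TWO print-shaped typed nodes about Castella's base Selmer group
`Sel_𝔭(K, ·[3^∞])` (`X11b.AcSelmer.selmerAcBase`): KL3-B at the ADDITIVE curve `W` (consumed only as
"`#Ш = 1` + unit log ⇒ `Sel = 0`", PROVED in part 8) and KL3-G `GoodBaseSelmerCountThree` at the GOOD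
companion `G` (consumed as "`Sel = 0` ⇒ `Ш(G/K)[3^∞] = 0` ∧ `ord₃((#G̃(𝔽₃)/3)·log P) = ord₃ [G(K):ℤP]`", which
needs the EXACT count, i.e. BOTH inclusions of Poitou–Tate). This file (part 10a) proves the exact count
ONCE, for every prime and every reduction type; part 10b (`O5/HeegnerLogTransportThreeGoodSelmer.lean`)
specialises it to KL3-G (good `3`) and to the additive prime `3`.

§0 `natCard_primaryComponent_eq_one_of_forall` — folklore: no `p`-torsion ⇒ trivial `p`-primary component.

§1 `natCard_selmerAcBase_eq_pow_of_noLocalTorsion` — **the exact base Selmer count at a rank-one datum under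
(iv), for EVERY prime `p` and EVERY reduction type**: for `W/ℚ` globally minimal with `W(ℚ_p)[p] = 0`, an
imaginary quadratic `K`, `rank W(K) = 1`, `Ш(W/K)` finite, `P ∈ W(K)` of infinite order and a degree-one prime
`𝔭 ∣ p` of `K`: `Sel_𝔭(K, W[p^∞])` is finite of order `p^a`,
`a = ord_p #Ш(W/K)[p^∞] + 2·(ord_p log_ω P + ord_p c_p + ord_p #W̃_ns(𝔽_p) − 1 − ord_p [W(K) : ℤP])`.
This is the cell's `X11b.natCard_selmerAcBase_mul_eq_of_rankOne` (JSW17 Prop. 3.2.1 with `=`, gen 19 of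
sub-cell multr1-p2, stated there at a MULTIPLICATIVE `p`) with its single multiplicative input — the local
exponent `e = ord_p log + ord_p c_p − 1` (`#Ẽ_ns(𝔽_p) = p ∓ 1` a unit) — replaced by the tree's
reduction-type-free exponent `LocalIndex.exists_addEquiv_valuation_psi_padicPointOf`
(`e = ord_p log + ord_p c_p + ord_p #Ẽ_ns(𝔽_p) − 1`), the finiteness of the Selmer group taken from the
(iv) level bound (the template `X11b.p2SelmerCardBoundAt_of_facts`, exponent symbolic) instead of
`selmerCardBoundTorsion_of_rankOne`, and `#W(ℚ_p)[p^∞] = 1` by (iv). Everything else — the exact level count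
`SelmerLevelCount.natCard_level_eq_of_indices` (both halves of Poitou–Tate for Selmer structures,
`poitouTate_selmerStructure_duality K`, and the local Euler characteristic, hypotheses), the level/limit
comparison, the `ℤ_p`-line index algebra — is the X11b machinery verbatim. CONDITIONAL on the two displayed
textbook facts (tree named facts with sources, consumed as hypotheses exactly as X11b consumes them).

References: [JetchevSkinnerWan2017] Prop. 3.2.1 and its proof (arXiv:1512.06894 pp. 10–11), §7.1 (7.1.5)
(pp. 15–16); [Castella2018] Def. 2.2, proof of Thm. 2.3, (3.2.1)+(calcul) (arXiv:1704.06608 pp. 5–6);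
[MilneADT2006] Ch. I Cor. 2.3, Thm. 2.8, Thm. 4.10; [Howard2004HeegnerKolyvagin] Thm. 2.1.11;
[SilvermanAEC2009] VII.2.1, VII.6.1, Ex. 8.19(a); [TateLNM476] §1, §6; cell files
`X11b/BDPRouteSelmerCountExact.lean` (the template, multiplicative `p`), `X11b/BDPRouteSelmerLevelCountExact.lean`,
`X11b/BDPRouteSelmerCardBound.lean`, `X11b/BDPRouteLocalIndexTorsion.lean`, `O5/HeegnerLogTransportThreeOrdSelmer.lean`.

## TYPER PLACEMENT NOTE

Imports ONLY tree files (part 4 `O5/HeegnerLogTransportThreeOrdSelmer.lean`, `X11b/BDPRouteSelmerCountExact.lean`,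
`X11b/BDPRouteSelmerCardBound.lean`): independent of parts 7–9 and placeable at once; part 10b
(`O5/HeegnerLogTransportThreeGoodSelmer.lean`) imports it, part 9 (`O5/HeegnerLogTransportThreeResidualEndFacts.lean`)
imports part 10b. THEOREMS only, namespace `Summit.BirchSwinnertonDyer.Rank1Residual.O5.HeegnerLogTransport`;
no `def`. `lean check` rc 0, 0 sorries, 0 warnings; axioms `propext`, `Classical.choice`, `Quot.sound` (o5-r2 GEN 21).

## Design

No definitions; `noncomputable section`; `open scoped Classical`. §1 is X11b's `natCard_selmerAcBase_mul_eq_of_rankOne`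
ported line by line (credit: sub-cell multr1-p2 gens 16–19); the only new ingredients are the (iv) finiteness
block, the reduction-type-free exponent and `natCard_primaryComponent_eq_one_of_forall`.

## TYPER PLACEMENT NOTE (cc-typer-5 GEN 18 = O5 §3.5 / O6 §3.4 typer of record; by-name ask A-O5-G21-1 of o5-r2 GEN 21, HOME/INBOX.md l.13972:
'AFTER part 7, place by sha … parts 8, 10a, 10b, 9 — every file ≤ 353 l.')

Source: `HOME/b2b-bsdres-o5-r2/gen21/lean/HeegnerLogTransportThreeExactCount.lean` sha16 `6fc473b403f72c99` (353 l.; `gen21/SHA16.txt`; o5-r2's `lean check` rc 0 / 0 warnings and joint scratch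
`gen21/lean/scratch/scratch_p7_8_10ab_9.lean` b9f2316600933a64 rc 0, axioms of `o5_index_unit_of_ordinary_companion_facts` std), re-hashed by the typer right before writing;
THIS file = KL3 part 10a = the source VERBATIM + this paragraph (imports, module text, every declaration block byte-identical; script `class-closure/typer-5/gen18/g21_place.py`);
the typer's own joint farm check of parts 7 (R2) + 8 + 10a + 10b + 9 over the tree: rc 0 / 0 warnings, axioms std; DEDUP `lean search --decl` on the new names: no match.
CONTENT LABELS (sources, unchanged): THEOREMS ONLY — 0 `def`, 0 `@[conjecture]`, 0 Literature facts (net named-fact debt 0), no `sorry`; published inputs stay displayed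
hypotheses by NAME (`poitouTate_selmerStructure_duality`, `localEulerPoincareCharacteristic`, `gross_zagier`, `kolyvagin`, Yan–Zhu A10, Wuthrich L20, modularity) and the ONE
typed node on the END's path is KL3-A `KrizLiUnitBitTransportThree` (part 1, p340741); KL3-B / KL3-G are NOT re-worded (their consumed directions are PROVED here / in part 10b).
KL3 parts in the tree: 1–3 p340741 / p341262 / p341640, Global p342632, OrdCompanion p343587 + p344465, OrdSelmer p345030 + p345686, OrdTwist p346273, Residual Engine p347366 +
Residual p348865 (+ End), Literature index lemma p344022.  HONEST FRAMING (cell `b2b-bsdres`): research route, lane CLASS-CLOSURE §3.5 O5; nothing asserted beyond the displayed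
binders, nothing booked, no mark of `RESIDUAL-MAP.md` moves; census = EVIDENCE, never a Literature fact; O5 OPEN.
-/

set_option autoImplicit false

noncomputable section

open scoped Classical

open WeierstrassCurve NumberField IsDedekindDomain Field
open Literature.NumberTheory.EllipticCurves Literature.NumberTheory.EllipticCurves.GreenbergSelmer
  Literature.NumberTheory.EllipticCurves.ModularForms
  Literature.NumberTheory.EllipticCurves.Rank1Residual
  Literature.NumberTheory.EllipticCurves.Rank1Residual.Typed
  Literature.NumberTheory.GaloisRepresentations Literature.NumberTheory.GaloisCohomology

namespace Summit.BirchSwinnertonDyer.Rank1Residual.O5.HeegnerLogTransport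

/-! ## §0 A folklore lemma: no `p`-torsion ⇒ trivial `p`-primary part -/

/-- `A[p] = 0 ⟹ #A[p^∞] = 1`. [folklore] -/
theorem natCard_primaryComponent_eq_one_of_forall {A : Type*} [AddCommGroup A] (p : ℕ) [Fact p.Prime]
    (h : ∀ x : A, p • x = 0 → x = 0) : Nat.card (AddCommGroup.primaryComponent A p) = 1 := by
  have key : ∀ (n : ℕ) (x : A), p ^ n • x = 0 → x = 0 := by
    intro n
    induction n with
    | zero => intro x hx; rwa [pow_zero, one_nsmul] at hx
    | succ n ih =>
      intro x hx
      apply h x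
      apply ih
      rw [smul_smul, ← pow_succ, hx]
  have hbot : AddCommGroup.primaryComponent A p = ⊥ := by
    refine (AddSubgroup.eq_bot_iff_forall _).mpr fun x hx => ?_
    obtain ⟨n, hn⟩ := (AddCommGroup.mem_primaryComponent).mp hx
    exact key n x hn
  rw [hbot, AddSubgroup.card_bot]

section ExactCount

open Summit.BirchSwinnertonDyer.Rank1Residual.X11b
open Summit.BirchSwinnertonDyer.Rank1Residual.X11b.AcSelmer
open Summit.BirchSwinnertonDyer.Rank1Residual.X11b.LocBridge

/-! ## §1 The exact base Selmer count at a rank-one datum under (iv): every prime, every reduction type -/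

/-- **THE EXACT BASE SELMER COUNT under (iv) (JSW17 Prop. 3.2.1 with (7.1.5), `=`, any reduction type).**
For `W/ℚ` globally minimal with `W(ℚ_p)[p] = 0`, `K` imaginary quadratic, `rank W(K) = 1`, `Ш(W/K)` finite,
`P ∈ W(K)` of infinite order and a degree-one `𝔭 ∣ p`: `#Sel_𝔭(K, W[p^∞]) = p^a`,
`a = ord_p #Ш[p^∞] + 2·(ord_p log_ω P + ord_p c_p + ord_p #W̃_ns(𝔽_p) − 1 − ord_p [W(K) : ℤP])`.
CONDITIONAL on `poitouTate_selmerStructure_duality K` and `localEulerPoincareCharacteristic (K_v)`, hypotheses.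
[cite: JetchevSkinnerWan2017, Prop. 3.2.1 and (7.1.5) (arXiv:1512.06894 pp. 10–11, 16)]
[cite: Castella2018, Thm. 2.3 and its proof, (3.2.1), (calcul) (arXiv:1704.06608 pp. 5–6)]
[cite: MilneADT2006, Ch. I, Thm. 4.10 and Thm. 2.8] -/
theorem natCard_selmerAcBase_eq_pow_of_noLocalTorsion (W : WeierstrassCurve ℚ) [W.IsElliptic]
    [W.IsGloballyMinimal] (p : ℕ) [Fact p.Prime]
    (hiv : ∀ R : (W.baseChange ℚ_[p]).toAffine.Point, p • R = 0 → R = 0)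
    (K : Type) [Field K] [NumberField K] (hK : IsImaginaryQuadratic K)
    (hPT : poitouTate_selmerStructure_duality K)
    (hEP : ∀ v : HeightOneSpectrum (𝓞 K), localEulerPoincareCharacteristic (v.adicCompletion K))
    (hrank : (W.baseChange K).mordellWeilRank = 1) (hSha : (W.baseChange K).ShaFinite)
    (P : (W.baseChange K).toAffine.Point) (hPinf : ¬ IsOfFinAddOrder P)
    (𝔭 : HeightOneSpectrum (𝓞 K)) (h𝔭 : ((p : ℕ) : 𝓞 K) ∈ 𝔭.asIdeal)
    (he : 𝔭.asIdeal.ramificationIdx (𝓞 ℚ) = 1) (hf : 𝔭.asIdeal.inertiaDeg (𝓞 ℚ) = 1) :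
    ∃ (_ : Finite (selmerAcBase (W.baseChange K) p 𝔭 ∅)) (a : ℕ),
      Nat.card (selmerAcBase (W.baseChange K) p 𝔭 ∅) = p ^ a ∧
      (a : ℤ) =
        (padicValNat p (Nat.card (AddCommGroup.primaryComponent (W.baseChange K).sha p)) : ℤ) +
        2 * (padicLogOrd W p (embAt K p 𝔭 h𝔭 he hf) P +
              padicValNat p ((W.baseChange ℚ_[p]).localTamagawaNumber ℤ_[p]) +
              padicValNat p (reductionPointCount W p) - 1 -
          (padicValNat p (AddSubgroup.zmultiples P).index : ℤ)) := by
  revert P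
  set E := W.baseChange K with hEdef
  set G := W.baseChange ℚ_[p] with hGdef
  intro P hPinf
  haveI hEK : E.IsElliptic := by rw [hEdef, baseChange]; infer_instance
  have h2 : Module.finrank ℚ K = 2 := hK.1
  haveI : IsTotallyComplex K := hK.2
  have hKc : ∀ w : InfinitePlace K, w.IsComplex := fun w => IsTotallyComplex.isComplex w
  have hp : p.Prime := Fact.out
  haveI hShaFin : Finite E.sha := hSha
  have hPTsum : poitouTate_sum_localTatePairing_eq_zero K :=
    poitouTate_sum_localTatePairing_eq_zero_of_selmerStructure_duality hPT
  -- `p` splits in the quadratic field `K` (a degree-one prime above it)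
  have hsplit : SplitsIn K p := by
    have h := (splitsIn_primesEquiv_under_iff h2 𝔭).mpr ⟨he, hf⟩
    rwa [under_eq_ratPlace_of_mem h𝔭, primesEquiv_ratPlace] at h
  -- the embedding `ι_𝔭 : K → ℚ_p` and `f : E(K) → E(ℚ_p)`
  set ιp := embAt K p 𝔭 h𝔭 he hf with hιp
  set f : E.toAffine.Point →+ G.toAffine.Point := Affine.Point.map (W' := W) ιp.toRatAlgHom with hfdef
  have hfapply : ∀ x, f x = padicPointOf W p ιp x := fun _ => rfl
  have hfinj : Function.Injective f := Affine.Point.map_injective (W' := W) ιp.toRatAlgHom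
  -- no `p`-torsion in `E(K)` (from (iv) along `f`)
  have hivK : ∀ x : E.toAffine.Point, p • x = 0 → x = 0 := fun x hx => by
    have h1 : f x = 0 := hiv (f x) (by rw [← map_nsmul, hx, map_zero])
    exact hfinj (by rw [h1, map_zero])
  -- a coordinate `c : E(K) → ℤ` and a generator `Q`
  obtain ⟨c, Q, hcQ, hcker⟩ := RankOne.exists_coord_of_mordellWeilRank_eq_one E hrank
  have hA : ∀ a : E.toAffine.Point, IsOfFinAddOrder (a - c a • Q) :=
    RankOne.isOfFinAddOrder_sub_coord_zsmul c Q hcQ hcker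
  have hQinf : ¬ IsOfFinAddOrder Q := fun hQ => by
    have h := RankOne.coord_eq_zero_of_isOfFinAddOrder c hQ
    rw [hcQ] at h
    exact one_ne_zero h
  have hxinf : ¬ IsOfFinAddOrder (f Q) := fun hx => hQinf ((hfinj.isOfFinAddOrder_iff).mp hx)
  have hyinf : ¬ IsOfFinAddOrder (f P) := fun hy => hPinf ((hfinj.isOfFinAddOrder_iff).mp hy)
  have hcP : c P ≠ 0 := fun h0 => hPinf (hcker P h0)
  haveI hfi2 : (G.formalFiltration 2).FiniteIndex := G.finiteIndex_formalFiltration 2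
  set cp := padicValNat p (G.localTamagawaNumber ℤ_[p]) with hcpdef
  set np := padicValNat p (reductionPointCount W p) with hnpdef
  -- the two primes above `p`, the (iv)-vanishing `H⁰(K_𝔭, E[p^∞]) = 0`, `#Ш[p^∞] = p^t`
  obtain ⟨σ, 𝔮, hσ, hne, h𝔮p, hall⟩ :=
    LocalIndexTransport.exists_conj_prime_of_splitsIn K p h2 hsplit h𝔭
  have h𝔮 : ∀ v : HeightOneSpectrum (𝓞 K), v ≠ 𝔭 → ((p : ℕ) : 𝓞 K) ∈ v.asIdeal → v = 𝔮 :=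
    fun v hv hpv => (hall v hpv).resolve_left hv
  obtain ⟨eKp⟩ := exists_ringHom_adicCompletion_padic_of_degreeOne p 𝔭 h𝔭 he hf
  have hKv := noPTorsion_baseChange_adicCompletion_of_padic W p 𝔭 eKp hiv
  have hΓv := LocalIndexTransport.eq_zero_of_forall_restrictField_eq E p 𝔭 hKv
  obtain ⟨t, ht⟩ : ∃ t : ℕ, Nat.card (AddCommGroup.primaryComponent E.sha p) = p ^ t :=
    X11b.exists_natCard_primaryComponent_eq_pow p
  -- §A FINITENESS of `Sel_𝔭(K, E[p^∞])`: the (iv) level bound with the exponent of `Q_ι` symbolic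
  obtain ⟨e₁, -, he₁⟩ := LocalIndex.index_range_nsmul_sup_zmultiples_padicPointOf W p hiv ιp Q hxinf 0
  have he₁k : ∀ k, ((nsmulAddMonoidHom (p ^ k) : G.toAffine.Point →+ _).range ⊔
      AddSubgroup.zmultiples (padicPointOf W p ιp Q)).index = p ^ min k e₁ := by
    intro k
    obtain ⟨e', h1, h2'⟩ :=
      LocalIndex.index_range_nsmul_sup_zmultiples_padicPointOf W p hiv ιp Q hxinf k
    have : e' = e₁ := by exact_mod_cast h2'.trans he₁.symm
    rw [h1, this]
  set B : ℕ := p ^ e₁ * (p ^ t * p ^ e₁) with hBdef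
  have hlevelB : ∀ k, Finite (acLevelStructure E p k 𝔭 ∅).selmerGroup ∧
      Nat.card (acLevelStructure E p k 𝔭 ∅).selmerGroup ≤ B := by
    intro k
    rcases Nat.eq_zero_or_pos k with rfl | hk
    · obtain ⟨hfin0, hle⟩ := finite_and_natCard_selmerGroup_acLevelStructure_zero E p 𝔭 ∅
      refine ⟨hfin0, hle.trans ?_⟩
      calc 1 ≤ p ^ t := Nat.one_le_pow _ _ hp.pos
        _ ≤ p ^ t * p ^ e₁ := Nat.le_mul_of_pos_right _ (pow_pos hp.pos _)
        _ ≤ p ^ e₁ * (p ^ t * p ^ e₁) := Nat.le_mul_of_pos_left _ (pow_pos hp.pos _)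
    · have hL : ((Affine.Point.baseChange (W' := W.baseChange K) K (𝔭.adicCompletion K)).range ⊔
          (zsmulAddGroupHom ((p ^ k : ℕ) : ℤ) :
            ((W.baseChange K).baseChange (𝔭.adicCompletion K)).toAffine.Point →+ _).range).index =
          p ^ min k e₁ := by
        rw [LocalIndexTransport.index_range_baseChange_sup_eq_padic K p 𝔭 h𝔭 he hf W,
          RankOne.range_zsmulAddGroupHom_natCast, sup_comm]
        change ((nsmulAddMonoidHom (p ^ k) : G.toAffine.Point →+ _).range ⊔ f.range).index = _
        rw [RankOne.range_nsmul_sup_range_eq G f c Q hA k hiv]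
        exact he₁k k
      have hM : ((zsmulAddGroupHom ((p ^ k : ℕ) : ℤ) :
          ((W.baseChange K).baseChange (𝔭.adicCompletion K)).toAffine.Point →+ _).range).index =
          p ^ k := by
        rw [LocalIndexTransport.index_range_zsmul_eq_padic K p 𝔭 h𝔭 he hf W,
          RankOne.range_zsmulAddGroupHom_natCast]
        exact RankOne.index_range_nsmul_pow_padic G hiv _ hxinf k
      have hN : ((zsmulAddGroupHom ((p ^ k : ℕ) : ℤ) : E.toAffine.Point →+ _).range).index =
          p ^ k := RankOne.index_range_zsmul_pow_eq c Q hcQ hcker hivK k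
      obtain ⟨hfink, hle⟩ := SelmerLevelBound.natCard_level_le_of_indices W K p k 𝔭 𝔮 hk σ hσ
        h𝔮 hΓv hPTsum (hEP 𝔮) hL hM (pow_ne_zero _ hp.ne_zero) hN
        (natCard_sha_inf_torsionBy_le E p k)
      refine ⟨hfink, hle.trans ?_⟩
      have hmin : p ^ min k e₁ ≤ p ^ e₁ := Nat.pow_le_pow_right hp.pos (min_le_right _ _)
      rw [ht]
      exact Nat.mul_le_mul hmin (Nat.mul_le_mul_left _ hmin)
  obtain ⟨hfinSel, -⟩ := LevelKummer.exists_finite_selmerAcBase_natCard_le E p 𝔭 ∅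
    E.zsmul_geomPoints_surjective_holds B (fun k => (hlevelB k).1) (fun k => (hlevelB k).2)
  -- §B the `p`-adic bookkeeping through `Ψ_φ : E(ℚ_p) → ℤ_p` (reduction-type-free exponent)
  obtain ⟨φ, hφ⟩ := LocalIndex.exists_addEquiv_valuation_psi_padicPointOf W p (K := K)
  obtain ⟨m, hmrange, hmcard, hmle⟩ :=
    LocalIndex.exists_pow_eq_card_and_le_valuation_psi (G.formalFiltration 2) φ
  set Ψ := LocalIndex.psi (G.formalFiltration 2) φ with hΨ
  set eQ := (Ψ (f Q)).valuation with heQdef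
  set eP := (Ψ (f P)).valuation with hePdef
  have hΨQ : Ψ (f Q) ≠ 0 := fun h0 => hxinf ((LocalIndex.psi_eq_zero_iff _ φ _).mp h0)
  have hmeQ : m ≤ eQ := hmle (f Q) hΨQ
  have heP : (eP : ℤ) = padicLogOrd W p ιp P + cp + np - 1 := hφ ιp P hyinf
  have hyx : f P = c P • f Q + f (P - c P • Q) := by rw [map_sub, map_zsmul]; abel
  have hePQ : eP = padicValNat p (c P).natAbs + eQ := by
    rw [hePdef, hyx]
    exact LocalIndex.valuation_psi_zsmul_add (G.formalFiltration 2) φ hxinf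
      (f.isOfFinAddOrder (hA P)) hcP
  haveI : Finite (AddCommGroup.torsion E.toAffine.Point) := E.finite_torsion_point
  have hI : padicValNat p (AddSubgroup.zmultiples P).index = padicValNat p (c P).natAbs :=
    RankOne.padicValNat_index_zmultiples_eq c Q hcQ hcker hivK P hcP
  -- (iv): `#E(ℚ_p)[p^∞] = 1`, so `m = 0`
  have hm0 : m = 0 := by
    have h1 : Nat.card (AddCommGroup.primaryComponent G.toAffine.Point p) = 1 :=
      natCard_primaryComponent_eq_one_of_forall p hiv
    rw [h1] at hmcard
    rcases Nat.eq_zero_or_pos m with hm | hm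
    · exact hm
    · exfalso
      have h3 : p ^ 1 ≤ p ^ m := Nat.pow_le_pow_right hp.pos hm
      rw [pow_one] at h3
      have h4 := hp.two_le
      omega
  -- the exponent of Castella's Selmer group
  have hcardeq := AcSelmer.natCard_selmerAcBase_eq_natCard_selmerGroup E p 𝔭
    (∅ : Set (HeightOneSpectrum (𝓞 K)))
  haveI hfinH : Finite (acStructure (primaryGaloisModule E p) p 𝔭 ∅).selmerGroup := by
    apply Nat.finite_of_card_ne_zero
    rw [← hcardeq]
    haveI := hfinSel
    exact Nat.card_pos.ne'
  obtain ⟨k₀, -, hk₀⟩ := AcSelmer.exists_pow_nsmul_eq_zero_of_finite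
    (acStructure (primaryGaloisModule E p) p 𝔭 ∅).selmerGroup
  -- THE LEVEL `k`
  set k : ℕ := k₀ + ((eQ - m) + (eQ + t)) + 1 with hkdef
  have hk0 : 0 < k := by omega
  have hjk : eQ + t ≤ k := by omega
  have hsk : (eQ - m) + (eQ + t) ≤ k := by omega
  have hkill : ∀ x ∈ (acStructure (primaryGaloisModule E p) p 𝔭 ∅).selmerGroup, p ^ k • x = 0 := by
    intro x hx
    have hkk : k = (k - k₀) + k₀ := by omega
    rw [hkk, pow_add, mul_nsmul', hk₀ x hx, nsmul_zero]
  have hΓ := SelmerCount.noInvariants_of_forall_torsion_eq_zero E p hivK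
  have hcount : Nat.card (selmerAcBase E p 𝔭 ∅) =
      Nat.card (acLevelStructure E p k 𝔭 ∅).selmerGroup :=
    AcSelmer.natCard_selmerAcBase_eq_natCard_level E p k 𝔭 ∅ E.zsmul_geomPoints_surjective_holds
      hΓ hkill
  -- the symbolic indices at level `k`, read in `E(ℚ_p)` through `Ψ`
  have hN : ((zsmulAddGroupHom ((p ^ k : ℕ) : ℤ) : E.toAffine.Point →+ _).range).index = p ^ k :=
    RankOne.index_range_zsmul_pow_eq c Q hcQ hcker hivK k
  have hM : (AddCommGroup.torsion ((W.baseChange K).baseChange (𝔭.adicCompletion K)).toAffine.Point ⊔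
      (zsmulAddGroupHom ((p ^ k : ℕ) : ℤ) :
        ((W.baseChange K).baseChange (𝔭.adicCompletion K)).toAffine.Point →+ _).range).index =
      p ^ k := by
    rw [index_torsion_sup_range_zsmul_eq_padic K p 𝔭 h𝔭 he hf W,
      RankOne.range_zsmulAddGroupHom_natCast]
    exact LocalIndex.index_torsion_sup_range_nsmul (G.formalFiltration 2) φ k
  have hL₁ : ∀ k' : ℕ, eQ ≤ k' →
      ((Affine.Point.baseChange (W' := W.baseChange K) K (𝔭.adicCompletion K)).range ⊔
        (zsmulAddGroupHom ((p ^ k' : ℕ) : ℤ) :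
          ((W.baseChange K).baseChange (𝔭.adicCompletion K)).toAffine.Point →+ _).range).index =
        p ^ eQ := by
    intro k' hk'
    rw [LocalIndexTransport.index_range_baseChange_sup_eq_padic K p 𝔭 h𝔭 he hf W,
      RankOne.range_zsmulAddGroupHom_natCast, sup_comm]
    change ((nsmulAddMonoidHom (p ^ k') : G.toAffine.Point →+ _).range ⊔ f.range).index = _
    rw [LocalIndex.range_nsmul_sup_range_eq_of_source f c Q hA k' hivK]
    exact LocalIndex.index_range_nsmul_sup_zmultiples_eq_pow_valuation (G.formalFiltration 2) φ
      hmrange hmcard (f Q) hxinf hk'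
  have hL₂ : ∀ k' : ℕ, eQ - m ≤ k' →
      ((Affine.Point.baseChange (W' := W.baseChange K) K (𝔭.adicCompletion K)).range ⊔
        (AddCommGroup.torsion ((W.baseChange K).baseChange (𝔭.adicCompletion K)).toAffine.Point ⊔
          (zsmulAddGroupHom ((p ^ k' : ℕ) : ℤ) :
            ((W.baseChange K).baseChange (𝔭.adicCompletion K)).toAffine.Point →+ _).range)).index =
        p ^ (eQ - m) := by
    intro k' hk'
    rw [index_range_baseChange_sup_torsion_sup_eq_padic K p 𝔭 h𝔭 he hf W,
      RankOne.range_zsmulAddGroupHom_natCast]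
    change (f.range ⊔ (AddCommGroup.torsion G.toAffine.Point ⊔
      (nsmulAddMonoidHom (p ^ k') : G.toAffine.Point →+ _).range)).index = _
    have hrw : f.range ⊔ (AddCommGroup.torsion G.toAffine.Point ⊔
        (nsmulAddMonoidHom (p ^ k') : G.toAffine.Point →+ _).range) =
        AddCommGroup.torsion G.toAffine.Point ⊔
          ((nsmulAddMonoidHom (p ^ k') : G.toAffine.Point →+ _).range ⊔
            AddSubgroup.zmultiples (f Q)) := by
      rw [← LocalIndex.range_nsmul_sup_range_eq_of_source f c Q hA k' hivK]
      ac_rfl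
    rw [hrw, LocalIndex.index_torsion_sup_range_nsmul_sup_zmultiples (G.formalFiltration 2) φ
      hmrange (f Q) hxinf k', min_eq_right hk']
  have hS := SelmerCount.natCard_sha_inf_torsionBy_eq E p ht (show t ≤ k by omega)
  have hShaj : ∀ z ∈ E.sha ⊓ AddSubgroup.torsionBy E.galH1 ((p ^ k : ℕ) : ℤ), p ^ t • z = 0 :=
    fun z hz => SelmerCount.pow_nsmul_eq_zero_of_mem_sha_inf_torsionBy E p ht k hz
  -- THE EXACT LEVEL COUNT
  obtain ⟨-, hlevel⟩ := SelmerLevelCount.natCard_level_eq_of_indices W K p k 𝔭 𝔮 hKc hk0 σ hσ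
    h𝔮p hne hall hPT hEP (exceptionalPlaces W K p h2) (inl_mem_exceptionalPlaces h2)
    (fun v hv => inr_mem_exceptionalPlaces_of_mem h2 hv)
    (fun v hv => inr_mem_exceptionalPlaces_of_not_hasGoodReductionAt h2 hv)
    (inr_mem_exceptionalPlaces_of_mem h2 h𝔮p) hivK hjk hsk hN hM (hL₁ k (by omega))
    (hL₁ (k - t) (by omega)) (hL₂ k (by omega)) (hL₂ (k - (eQ + t)) (by omega)) hS hShaj
  -- assemble
  refine ⟨hfinSel, t + 2 * eQ, ?_, ?_⟩
  · rw [hcount, hlevel, ht, hm0, Nat.sub_zero, ← pow_add]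
    congr 1
    omega
  · have hvS : padicValNat p (Nat.card (AddCommGroup.primaryComponent E.sha p)) = t := by
      rw [ht, padicValNat.prime_pow]
    rw [hvS, hI]
    have hePQZ : (eP : ℤ) = (padicValNat p (c P).natAbs : ℤ) + (eQ : ℤ) := by exact_mod_cast hePQ
    have hcast : (((t + 2 * eQ : ℕ) : ℤ)) = (t : ℤ) + 2 * (eQ : ℤ) := by push_cast; ring
    rw [hcast]
    linarith [hePQZ, heP]

end ExactCount

end Summit.BirchSwinnertonDyer.Rank1Residual.O5.HeegnerLogTransport

end
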